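import Mathlib
import Summits.Langlands.Langlands.Theses.PhantomRMYoshida
import Summits.Langlands.Langlands.Theorems.PhantomRMYoshidaStableYoshidaCongruenceNonConjIdle
import Summits.Langlands.Langlands.Theorems.PhantomRMYoshidaStableYoshidaCongruenceIrrCloses
import Summits.Langlands.Langlands.Theorems.PhantomRMYoshidaStableYoshidaCongruenceResidualLatticeCharpoly
import Summits.Langlands.Langlands.Theorems.PhantomRMYoshidaStableYoshidaCongruenceOrdinaryFrameFp
import Summits.Langlands.Langlands.Theorems.PhantomRMYoshidaStableYoshidaCongruenceFramedH1
import Literature.NumberTheory.GaloisRepresentations.SymplecticMultiplierDeterminant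
import Literature.NumberTheory.GaloisRepresentations.ModPGaloisRepCyclotomicProofs
import HarnessLib

/-!
# Route `PhantomRMYoshida`, crux `StableYoshidaCongruence` (stmt-Langlands-13640): the second
# determinant hypothesis is idle; the crux with its minimal hypothesis list

Helper file (`--supports stmt-Langlands-13640`, line lead c20, 2026-08-17; companion of
`…NonConjIdle.lean`, p155497).  It does NOT close the crux.  It proves, against the route declaration BY
NAME, that the second half of the determinant hypothesis (H3b) `det σ' = det σ` is DERIVABLE from the
first half (H3a) `det σ = ε̄⁻¹` and the witness hypothesis (H5) `∃ ρ, Sh ρ` — for EVERY prime `p`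
(oddness is not used) — and records the crux with both idle hypotheses (H3b, H4) deleted:
`stableYoshidaCongruence_iff_minimalHyps` (named form) / `…_verbatim` (route syntax).

Proof of (H3b) (`det_eq_det_of_det_of_symplectic_of_hasResidualPair`), simpler than the self-duality
sketch of `Cruxes/StableYoshidaCongruence/Disproof.lean` §4 (no dihedral corner case arises): for every
`g ∈ Γ_ℚ` the characteristic polynomial of `ρ(g)` is the image of an integral `P` with
`red(P) = charpoly σ(g) · charpoly σ'(g)` (landed `exists_map_red_charpoly_eq_mul_of_hasResidualPair`,
Chebotarev + closedness, p115123); compare constant coefficients: `red(det ρ(g)) = det σ(g) · det σ'(g)`.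
A symplectic similitude of rank `4` has `det = ν²` (landed `IsSymplecticWithMultiplierFun.det_eq_sq`,
Pfaffian), so `det ρ(g) = ε(g)⁻²`, whose reduction through ANY `red : ℤ̄_p → k` is `ε̄(g)⁻²`
(`red ∘ (ℤ_p → ℤ̄_p) = (𝔽_p → k) ∘ (mod p)`, landed `red_comp_padicIntToInteger`; `ε mod p = ε̄`, tree
`toZMod_cyclotomicCharacter_apply`).  With `det σ(g) = ε̄(g)⁻¹ ≠ 0` this gives `det σ'(g) = ε̄(g)⁻¹`.
[folklore]
-/

set_option linter.dupNamespace false -- `Summit.Langlands.Langlands` is the mandated namespace (D-0017)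

noncomputable section

open Literature.NumberTheory.GaloisRepresentations Literature.NumberTheory.Automorphic
open IsDedekindDomain Matrix Polynomial
open scoped NumberField
open Summit.Langlands.Langlands.Theses.PhantomRMYoshida
open Summit.Langlands.Langlands.Cruxes.StableYoshidaCongruence.LevelThreeWeierstrassSwitch
  (epsBar invCyc Sh AutGL2 AutGL4 DetCond NonConj CruxAt crux_iff padicIntToInteger
    red_comp_padicIntToInteger)
open Summit.Langlands.Langlands.Cruxes.StableYoshidaCongruence.BurkhardtWeddleTwoThreeAnchor
  (exists_map_red_charpoly_eq_mul_of_hasResidualPair det_val_eq_of_det_eq)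

namespace Summit.Langlands.Langlands.Theorems.PhantomRMYoshida

section Main

variable {p : ℕ} [Fact p.Prime] {k : Type} [Field k] [CharP k p] [TopologicalSpace k]
  [DiscreteTopology k]

/-- `ε mod p = ε̄` on inverses: the reduction of `ε(g)⁻¹ ∈ ℤ_pˣ` is `ε̄(g)⁻¹ ∈ 𝔽_pˣ` (tree
`toZMod_cyclotomicCharacter_apply`; `ε̄` = the route's inline `epsBar`). [folklore] -/
theorem toZMod_cyclotomicCharacter_inv (g : Field.absoluteGaloisGroup ℚ) :
    PadicInt.toZMod (((GaloisRep.cyclotomicCharacter ℚ p g)⁻¹ : ℤ_[p]ˣ) : ℤ_[p]) =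
      (((epsBar p g)⁻¹ : (ZMod p)ˣ) : ZMod p) := by
  have hu : Units.map (PadicInt.toZMod (p := p)).toMonoidHom (GaloisRep.cyclotomicCharacter ℚ p g) =
      epsBar p g :=
    Units.ext (toZMod_cyclotomicCharacter_apply ℚ p g)
  rw [← hu, Units.coe_map_inv]
  rfl

/-- **(H3b) from (H3a) + (H5), every `p`.**  `σ, σ' : Γ_ℚ → GL₂(k)` with `det σ = ε̄⁻¹`;
`ρ : Γ_ℚ → GL₄(ℚ̄_p)` symplectic with multiplier `ε⁻¹` and with residual pair `(σ, σ')` through `red`.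
Then `det σ' = det σ`.  (Constant coefficients of `red(charpoly ρ(g)) = charpoly σ(g) · charpoly σ'(g)`
and `det ρ = ε⁻²`; see the module docstring.) [folklore] -/
theorem det_eq_det_of_det_of_symplectic_of_hasResidualPair
    {red : Valued.integer (PadicAlgCl p) →+* k} {σ σ' : FramedGaloisRep ℚ k 2}
    (hdet : ∀ g, FramedRep.det σ g =
      (Units.map (ZMod.castHom (dvd_refl p) k).toMonoidHom (epsBar p g))⁻¹)
    {ρ : FramedGaloisRep ℚ (PadicAlgCl p) 4} (hsymp : ρ.IsSymplecticWithMultiplierFun (invCyc p))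
    (hpair : ρ.HasResidualPair red σ σ') (g : Field.absoluteGaloisGroup ℚ) :
    FramedRep.det σ' g = FramedRep.det σ g := by
  haveI : CharZero (PadicAlgCl p) :=
    charZero_of_injective_algebraMap (algebraMap ℚ_[p] (PadicAlgCl p)).injective
  obtain ⟨P, hP, hPred⟩ := exists_map_red_charpoly_eq_mul_of_hasResidualPair red hpair g
  -- constant coefficients on the residual side: `red (P₀) = det σ(g) · det σ'(g)`
  have hc2 : ∀ s : FramedGaloisRep ℚ k 2,
      (FramedRep.charpoly s g).coeff 0 = ((s g : GL (Fin 2) k) : Matrix (Fin 2) (Fin 2) k).det := by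
    intro s
    rw [FramedRep.charpoly, Matrix.det_eq_sign_charpoly_coeff, Fintype.card_fin]
    norm_num
  have h0 : red (P.coeff 0) = ((σ g : GL (Fin 2) k) : Matrix (Fin 2) (Fin 2) k).det *
      ((σ' g : GL (Fin 2) k) : Matrix (Fin 2) (Fin 2) k).det := by
    have h := congrArg (fun Q : Polynomial k => Q.coeff 0) hPred
    simp only [Polynomial.coeff_map, Polynomial.mul_coeff_zero, hc2] at h
    exact h
  -- constant coefficient on the `p`-adic side: `P₀ = ε(g)⁻²`, an element of `ℤ_p`
  have hc4 : (FramedRep.charpoly ρ g).coeff 0 =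
      ((ρ g : GL (Fin 4) (PadicAlgCl p)) : Matrix (Fin 4) (Fin 4) (PadicAlgCl p)).det := by
    rw [FramedRep.charpoly, Matrix.det_eq_sign_charpoly_coeff, Fintype.card_fin]
    norm_num
  set u : ℤ_[p]ˣ := (GaloisRep.cyclotomicCharacter ℚ p g)⁻¹ with hu
  have hP0 : P.coeff 0 = padicIntToInteger p ((u : ℤ_[p]) ^ 2) := by
    apply Subtype.ext
    have h := congrArg (fun Q : Polynomial (PadicAlgCl p) => Q.coeff 0) hP
    simp only [Polynomial.coeff_map] at h
    rw [hc4, hsymp.det_eq_sq g] at h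
    rw [map_pow]
    change _ = (algebraMap ℤ_[p] (PadicAlgCl p) (u : ℤ_[p])) ^ 2
    rw [IsScalarTower.algebraMap_apply ℤ_[p] ℚ_[p] (PadicAlgCl p)]
    exact h
  have hred0 : red (P.coeff 0) =
      ZMod.castHom (dvd_refl p) k ((((epsBar p g)⁻¹ : (ZMod p)ˣ) : ZMod p) ^ 2) := by
    rw [hP0, ← RingHom.comp_apply, red_comp_padicIntToInteger, RingHom.comp_apply, map_pow, hu,
      toZMod_cyclotomicCharacter_inv, map_pow]
  -- compare
  have hσ : ((σ g : GL (Fin 2) k) : Matrix (Fin 2) (Fin 2) k).det =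
      ZMod.castHom (dvd_refl p) k (((epsBar p g)⁻¹ : (ZMod p)ˣ) : ZMod p) :=
    det_val_eq_of_det_eq (hdet g)
  have hne : ((σ g : GL (Fin 2) k) : Matrix (Fin 2) (Fin 2) k).det ≠ 0 := by
    rw [← Matrix.GeneralLinearGroup.val_det_apply]
    exact Units.ne_zero _
  have hmul : ((σ g : GL (Fin 2) k) : Matrix (Fin 2) (Fin 2) k).det *
      (((σ' g : GL (Fin 2) k) : Matrix (Fin 2) (Fin 2) k).det -
        ((σ g : GL (Fin 2) k) : Matrix (Fin 2) (Fin 2) k).det) = 0 := by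
    rw [mul_sub, ← h0, hred0, hσ, map_pow, sq, sub_self]
  have heq := sub_eq_zero.mp ((mul_eq_zero.mp hmul).resolve_left hne)
  refine Units.ext ?_
  rw [FramedRep.det_apply, FramedRep.det_apply, Matrix.GeneralLinearGroup.val_det_apply,
    Matrix.GeneralLinearGroup.val_det_apply]
  exact heq

/-- **(H3b) is idle, in the vocabulary of the landed sector file**: from `det σ = ε̄⁻¹` and any
`Sh`-witness, the full `DetCond p σ σ'`. [folklore] -/
theorem detCond_of_det_of_sh {red : Valued.integer (PadicAlgCl p) →+* k}
    {σ σ' : FramedGaloisRep ℚ k 2}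
    (hdet : ∀ g, FramedRep.det σ g =
      (Units.map (ZMod.castHom (dvd_refl p) k).toMonoidHom (epsBar p g))⁻¹)
    {ρ : FramedGaloisRep ℚ (PadicAlgCl p) 4} (hρ : Sh red σ σ' ρ) : DetCond p σ σ' :=
  fun g => ⟨hdet g, det_eq_det_of_det_of_symplectic_of_hasResidualPair hdet hρ.1 hρ.2.2 g⟩

end Main

/-- **The crux with its MINIMAL hypothesis list.**  Left: the route declaration
`Theses.PhantomRMYoshida.StableYoshidaCongruence` by name.  Right: the same conclusion at every datum
from `AutGL2 σ`, `AutGL2 σ'`, irreducibility of `σ` and `σ'`, `det σ = ε̄⁻¹` and `∃ ρ, Sh ρ` ONLY —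
the clauses `det σ' = det σ` (H3b, `detCond_of_det_of_sh`) and non-conjugacy (H4,
`nonConj_of_detCond_of_sh`, file `…NonConjIdle.lean`) being consequences of the others. [folklore] -/
theorem stableYoshidaCongruence_iff_minimalHyps :
    StableYoshidaCongruence ↔
      ∀ (p : ℕ) [Fact p.Prime], p ≠ 2 → ∀ (k : Type) [Field k] [CharP k p] [IsAlgClosed k]
        [TopologicalSpace k] [DiscreteTopology k] (red : Valued.integer (PadicAlgCl p) →+* k)
        (σ σ' : FramedGaloisRep ℚ k 2),
        AutGL2 red σ → AutGL2 red σ' → σ.toGaloisRep.IsIrreducible → σ'.toGaloisRep.IsIrreducible →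
          (∀ g, FramedRep.det σ g =
            (Units.map (ZMod.castHom (dvd_refl p) k).toMonoidHom (epsBar p g))⁻¹) →
            (∃ ρ : FramedGaloisRep ℚ (PadicAlgCl p) 4, Sh red σ σ' ρ) →
              ∀ (hcpt : isCompact_glFiniteIntegralLevel 4 ℚ) (ι : PadicAlgCl p ≃+* ℂ),
                ∃ ρ₀ : FramedGaloisRep ℚ (PadicAlgCl p) 4,
                  ρ₀.toGaloisRep.IsIrreducible ∧ Sh red σ σ' ρ₀ ∧ AutGL4 p hcpt ι ρ₀ := by
  rw [stableYoshidaCongruence_iff_dropNonConj]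
  constructor
  · intro h p _ hp k _ _ _ _ _ red σ σ' hA hA' hirr hirr' hdet hw hcpt ι
    obtain ⟨ρ, hρ⟩ := hw
    exact h p hp k red σ σ' hA hA' hirr hirr' (detCond_of_det_of_sh hdet hρ) ⟨ρ, hρ⟩ hcpt ι
  · intro h p _ hp k _ _ _ _ _ red σ σ' hA hA' hirr hirr' hdet hw hcpt ι
    exact h p hp k red σ σ' hA hA' hirr hirr' (fun g => (hdet g).1) hw hcpt ι

/-- **The same, right-hand side in the ROUTE'S OWN SYNTAX**: verbatim the text of
`Theses.PhantomRMYoshida.StableYoshidaCongruence` (item stmt-Langlands-13640) with the conjunct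
`∧ Literature.NumberTheory.GaloisRepresentations.FramedRep.det σ' g = … det σ g` and the clause
`(¬ ∃ g : GL (Fin 2) k, ∀ x, g * σ x * g⁻¹ = σ' x) →` deleted — ready to paste as a restated crux
(or, with `∃ ρ, Sh ρ` strengthened to an irreducible witness, as the child `StableYoshidaCongruenceIrr` of
`Cruxes/StableYoshidaCongruence/SPLIT.md`).  Definitionally the previous right-hand side. [folklore] -/
theorem stableYoshidaCongruence_iff_minimalHyps_verbatim : StableYoshidaCongruence ↔ (∀ (p : ℕ) [Fact p.Prime], p ≠ 2 → ∀ (k : Type) [Field k] [CharP k p] [IsAlgClosed k] [TopologicalSpace k] [DiscreteTopology k] (red : Valued.integer (PadicAlgCl p) →+* k) (σ σ' : Literature.NumberTheory.GaloisRepresentations.FramedGaloisRep ℚ k 2), let εb : Field.absoluteGaloisGroup ℚ →* (ZMod p)ˣ := (modularCyclotomicCharacter (AlgebraicClosure ℚ) (HasEnoughRootsOfUnity.natCard_rootsOfUnity (AlgebraicClosure ℚ) p)).comp (MulSemiringAction.toRingAut (Field.absoluteGaloisGroup ℚ) (AlgebraicClosure ℚ)); let Sh := fun r : Literature.NumberTheory.GaloisRepresentations.FramedGaloisRep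 ℚ (PadicAlgCl p) 4 => (r.IsSymplecticWithMultiplierFun (fun g => algebraMap ℚ_[p] (PadicAlgCl p) ((((Literature.NumberTheory.GaloisRepresentations.GaloisRep.cyclotomicCharacter ℚ p g)⁻¹ : ℤ_[p]ˣ) : ℤ_[p]) : ℚ_[p])) ∧ (∀ v : IsDedekindDomain.HeightOneSpectrum (NumberField.RingOfIntegers ℚ), ((p : ℕ) : NumberField.RingOfIntegers ℚ) ∈ v.asIdeal → r.IsGreenbergOrdinaryOfShapeAt v ![0, 0, 1, 1] ∧ r.IsResiduallyDistinguishedAt v ![0, 0, 1, 1]) ∧ (∀ᶠ v : IsDedekindDomain.HeightOneSpectrum (NumberField.RingOfIntegers ℚ) in Filter.cofinite, r.IsUnramifiedAt v ∧ σ.IsUnramifiedAt v ∧ σ'.IsUnramifiedAt v ∧ ∃ (P : Polynomial (Valued.integer (PadicAlgCl p))) (P₁ P₂ : Polynomial k), r.HasFrobCharpolyAt v (P.map (Valued.integer (PadicAlgCl p)).subtype) ∧ σ.HasFrobCharpolyAt v P₁ ∧ σ'.HasFrobCharpolyAt v P₂ ∧ P.map red = P₁ * P₂)); let AutGL2 :=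 fun s : Literature.NumberTheory.GaloisRepresentations.FramedGaloisRep ℚ k 2 => (∀ (hcpt₂ : Literature.NumberTheory.Automorphic.isCompact_glFiniteIntegralLevel 2 ℚ) (ι : PadicAlgCl p ≃+* ℂ), ∃ π₂ : Literature.NumberTheory.Automorphic.CuspidalAutomorphicRepData 2 ℚ hcpt₂, π₂.1.IsLAlgebraic ∧ ∀ᶠ v : IsDedekindDomain.HeightOneSpectrum (NumberField.RingOfIntegers ℚ) in Filter.cofinite, ∃ (a : Multiset ℂ) (P : Polynomial (Valued.integer (PadicAlgCl p))) (Pb : Polynomial k), π₂.1.HasSatakeParamAt v a ∧ P.map (Valued.integer (PadicAlgCl p)).subtype = Literature.NumberTheory.Automorphic.arithFrobPolyOfSatake ι v.residueCard 1 a ∧ s.IsUnramifiedAt v ∧ s.HasFrobCharpolyAt v Pb ∧ P.map red = Pb); AutGL2 σ → AutGL2 σ' → σ.toGaloisRep.IsIrreducible → σ'.toGaloisRep.IsIrreducible → (∀ g, Literature.NumberTheory.GaloisRepresentations.FramedRep.det σ g = (Units.map (ZMod.castHom (dvd_refl p) k).toMonoidHom (εb g))⁻¹) → (∃ ρ : Literature.NumberTheory.GaloisRepresentations.FramedGaloisRep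 ℚ (PadicAlgCl p) 4, Sh ρ) → ∀ (hcpt : Literature.NumberTheory.Automorphic.isCompact_glFiniteIntegralLevel 4 ℚ) (ι : PadicAlgCl p ≃+* ℂ), ∃ ρ₀ : Literature.NumberTheory.GaloisRepresentations.FramedGaloisRep ℚ (PadicAlgCl p) 4, ρ₀.toGaloisRep.IsIrreducible ∧ Sh ρ₀ ∧ (∃ π : Literature.NumberTheory.Automorphic.CuspidalAutomorphicRepData 4 ℚ hcpt, π.1.IsLAlgebraic ∧ ∀ᶠ v : IsDedekindDomain.HeightOneSpectrum (NumberField.RingOfIntegers ℚ) in Filter.cofinite, ∃ a : Multiset ℂ, π.1.HasSatakeParamAt v a ∧ ρ₀.IsUnramifiedAt v ∧ ρ₀.HasFrobCharpolyAt v (Literature.NumberTheory.Automorphic.arithFrobPolyOfSatake ι v.residueCard 1 a))) :=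
  stableYoshidaCongruence_iff_minimalHyps.trans Iff.rfl

/-- **Modulo the route's KW gate, the residual-automorphy hypotheses go too.**  Given the support item
`SerreKWAutomorphicGL2` (Khare–Wintenberger in the summit's normalisation, a hypothesis of the route's
deciding theorem), the crux is equivalent to: for `p` odd and every `(k, red, σ, σ')` with `σ, σ'`
irreducible and `det σ = ε̄⁻¹`, if the pair has SOME `Sh`-witness then for every `ι` it has an
irreducible automorphic one.  (`AutGL2` is fed by KW from oddness, which follows from `det σ = ε̄⁻¹`,
`det σ' = det σ` — landed `isOdd_of_det_eq_inv_epsBar`, file `…IrrCloses.lean`.)  This is the crux's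
content in its leanest form. [folklore] -/
theorem stableYoshidaCongruence_iff_core_of_KW (hKW : SerreKWAutomorphicGL2) :
    StableYoshidaCongruence ↔
      ∀ (p : ℕ) [Fact p.Prime], p ≠ 2 → ∀ (k : Type) [Field k] [CharP k p] [IsAlgClosed k]
        [TopologicalSpace k] [DiscreteTopology k] (red : Valued.integer (PadicAlgCl p) →+* k)
        (σ σ' : FramedGaloisRep ℚ k 2),
        σ.toGaloisRep.IsIrreducible → σ'.toGaloisRep.IsIrreducible →
          (∀ g, FramedRep.det σ g =
            (Units.map (ZMod.castHom (dvd_refl p) k).toMonoidHom (epsBar p g))⁻¹) →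
            (∃ ρ : FramedGaloisRep ℚ (PadicAlgCl p) 4, Sh red σ σ' ρ) →
              ∀ (hcpt : isCompact_glFiniteIntegralLevel 4 ℚ) (ι : PadicAlgCl p ≃+* ℂ),
                ∃ ρ₀ : FramedGaloisRep ℚ (PadicAlgCl p) 4,
                  ρ₀.toGaloisRep.IsIrreducible ∧ Sh red σ σ' ρ₀ ∧ AutGL4 p hcpt ι ρ₀ := by
  rw [stableYoshidaCongruence_iff_minimalHyps]
  constructor
  · intro h p _ hp k _ _ _ _ _ red σ σ' hirr hirr' hdet hw hcpt ι
    obtain ⟨ρ, hρ⟩ := hw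
    have hodd := isOdd_of_det_eq_inv_epsBar (detCond_of_det_of_sh hdet hρ)
    exact h p hp k red σ σ' (hKW p k red σ hodd.1 hirr) (hKW p k red σ' hodd.2 hirr') hirr hirr' hdet
      ⟨ρ, hρ⟩ hcpt ι
  · intro h p _ hp k _ _ _ _ _ red σ σ' _ _ hirr hirr' hdet hw hcpt ι
    exact h p hp k red σ σ' hirr hirr' hdet hw hcpt ι

end Summit.Langlands.Langlands.Theorems.PhantomRMYoshida

end
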